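import Summits.BirchSwinnertonDyer.BirchSwinnertonDyer.Theses.PAdicOrderV2
import Summits.BirchSwinnertonDyer.BirchSwinnertonDyer.Theorems.PAdicOrderV2PAdicOrderThesisR2StubUBRank0
import Literature.NumberTheory.EllipticCurves.OrdinaryPrimesProofs
import Literature.NumberTheory.EllipticCurves.LFunctionSmulProofs
import Literature.NumberTheory.EllipticCurves.RootNumberSmulProofs
import Literature.NumberTheory.EllipticCurves.GlobalMinimalModelProofs
import Literature.NumberTheory.DiophantineGeometry.Conductor

/-!
# BirchSwinnertonDyer / PAdicOrderV2 — crux `PAdicOrderThesisR2` (stmt-0487), line `Sketch`: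
# the sandwich decomposition is TIGHT (an exact reformulation of `X₅` modulo Kato and Carayol)

Line `Sketch` proves `X = PAdicOrderThesisR2` from five stubs: modularity (`stub_modularity`), the
Kato side (`stub_kato` = `PAdicOrderKatoSideR2`), the rank-0 window (`stub_UB_rank0`, PROVED), the
one-prime upper bound in positive analytic rank (`stub_UB_pos`) and the BSD lower bound for globally
minimal models (`stub_LB_rank1`, `stub_LB_ge2`). Earlier cycles showed the lower-bound stubs NECESSARY
for `X` (`stub_LB_*_of_thesis`) and modularity necessary in a weak form (`modularity_of_thesis`). This
file closes the audit of the line: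

* `thesisFiveLe_of_sandwich` — the composition actually proves the STRONGER `X₅` (`X` with its witness
  prime `≥ 5`, stated inline): the rank-0 prime comes from `exists_good_ordinary_prime_holds` (`p ≥ 5`)
  and the positive-rank prime from `stub_UB_pos` (`p ≥ 5`).
* `stub_UB_pos_of_level_eq_conductorNorm_of_thesisFiveLe` — conversely `X₅ ⇒ stub_UB_pos`, modulo
  Carayol's theorem `IsNewformOf.level_eq_conductorNorm` (level of a newform of `E` = conductor; a named
  fact of the tree, Carayol 1986 / Diamond–Shurman Thm 8.8.1): at the prime of `X₅` the newform `f₀`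
  with `ord = r_an` and ANY newform `f` of `E` live at level `N_E`, hence coincide (`IsNewformOf.unique`,
  `q`-expansion principle).
* `stub_modularity_of_level_eq_conductorNorm_of_thesisFiveLe` — `X₅ ⇒ stub_modularity` (all elliptic
  `W`, level `N_W`), modulo Carayol: pass to a global minimal model `C • W`
  (`hasGlobalMinimalModel_rat_holds`), take the newform of `X₅` there, move its level to
  `N_{C • W} = N_W` (`conductorNorm_smul`) and transport `IsNewformOf` along `C` (`LFunction_smul`).
* `stub_LB_rank1_of_thesisFiveLe`, `stub_LB_ge2_of_thesisFiveLe` — the lower-bound stubs from `X₅`.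
* `sandwich_tight` — **modulo Kato (`PAdicOrderKatoSideR2`, Kato 2004 Thm 18.4, in print) and Carayol
  (in print), `X₅ ↔ stub_modularity ∧ stub_UB_pos ∧ stub_LB_rank1 ∧ stub_LB_ge2`**: no stub of the line
  can be weakened without losing `X₅`, and nothing beyond the stubs is needed.

Nothing is asserted unconditionally about `X`; Kato and Carayol enter as explicit hypotheses.
-/

-- single-conjunct summit: `Summit.BirchSwinnertonDyer.BirchSwinnertonDyer.…` repeats the name by design
set_option linter.dupNamespace false

namespace Summit.BirchSwinnertonDyer.BirchSwinnertonDyer.Cruxes.PAdicOrderThesisR2.KatoSandwich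

open scoped MatrixGroups ModularForm
open CongruenceSubgroup
open Literature.NumberTheory.EllipticCurves Literature.NumberTheory.EllipticCurves.ModularForms
open Summit.BirchSwinnertonDyer.BirchSwinnertonDyer.Theses.PAdicOrderV2

/-! ## The composition proves `X₅` -/

/-- **The sandwich proves `X₅`.** From modularity (inlined as in `CruxesToThesis`), the Kato side
`PAdicOrderKatoSideR2` (stmt-0491), the registered stubs `stub_UB_pos`, `stub_LB_rank1`, `stub_LB_ge2`
(as hypotheses, verbatim) and the PROVED rank-0 window `stub_UB_rank0`: every `E/ℚ` (globally minimal
`W`) has a good ordinary prime `p ≥ 5` and a newform `f` (of level `N_W`) with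
`ord_{T=0} L_p(f, α_p, T) = r_an = r_MW`. Same proof as the skeleton's `PAdicOrderThesisR2_of`, keeping
`5 ≤ p` (rank 0: `exists_good_ordinary_prime_holds`; positive rank: the prime of `stub_UB_pos`).
[cite: Kato2004, Thm 18.4] -/
theorem thesisFiveLe_of_sandwich
    (hmod : ∀ (W : WeierstrassCurve ℚ) [W.IsElliptic] [NeZero (W.conductorNorm ℤ)],
      ∃ f : CuspForm (Gamma0 (W.conductorNorm ℤ)) 2, IsNewformOf W f)
    (hK : PAdicOrderKatoSideR2)
    (hUBpos : ∀ (W : WeierstrassCurve ℚ) [W.IsElliptic] [W.IsGloballyMinimal], 0 < W.analyticRank →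
      ∃ (p : ℕ) (_ : Fact p.Prime), 5 ≤ p ∧ IsOrdinaryAt W p ∧
        ∀ {N : ℕ} [NeZero N] (f : CuspForm (Gamma0 N) 2), IsNewformOf W f →
          (padicLFunction f (unitRoot W p : ℚ_[p])).order ≤ (W.analyticRank : ℕ∞))
    (hLB1 : ∀ (W : WeierstrassCurve ℚ) [W.IsElliptic] [W.IsGloballyMinimal],
      W.analyticRank = 1 → 1 ≤ W.mordellWeilRank)
    (hLB2 : ∀ (W : WeierstrassCurve ℚ) [W.IsElliptic] [W.IsGloballyMinimal],
      2 ≤ W.analyticRank → W.analyticRank ≤ W.mordellWeilRank) :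
    ∀ (W : WeierstrassCurve ℚ) [W.IsElliptic] [W.IsGloballyMinimal],
      ∃ (p : ℕ) (_ : Fact p.Prime), 5 ≤ p ∧ IsOrdinaryAt W p ∧
        ∃ (N : ℕ) (_ : NeZero N) (f : CuspForm (Gamma0 N) 2), IsNewformOf W f ∧
          (padicLFunction f (unitRoot W p : ℚ_[p])).order = W.analyticRank ∧
          (padicLFunction f (unitRoot W p : ℚ_[p])).order = W.mordellWeilRank := by
  intro W _ _
  haveI hN : NeZero (W.conductorNorm ℤ) := ⟨(W.conductorNorm_pos_holds).ne'⟩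
  obtain ⟨f, hf⟩ := hmod W
  rcases Nat.eq_zero_or_pos W.analyticRank with h0 | hpos
  · obtain ⟨p, hp, h5, hgood, hord⟩ := WeierstrassCurve.exists_good_ordinary_prime_holds W
    have hO : IsOrdinaryAt W p := ⟨hgood, hord⟩
    have hub : (padicLFunction f (unitRoot W p : ℚ_[p])).order = 0 := stub_UB_rank0 W p hO h0 f hf
    have hk : (W.mordellWeilRank : ℕ∞) ≤ (padicLFunction f (unitRoot W p : ℚ_[p])).order :=
      hK W p (by omega) hO f hf
    refine ⟨p, hp, h5, hO, W.conductorNorm ℤ, hN, f, hf, ?_, ?_⟩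
    · rw [hub, h0, Nat.cast_zero]
    · refine le_antisymm ?_ hk
      rw [hub]
      exact zero_le
  · obtain ⟨p, hp, h5, hO, hub⟩ := hUBpos W hpos
    have hLB : W.analyticRank ≤ W.mordellWeilRank := by
      rcases Nat.lt_or_ge W.analyticRank 2 with h1 | h2
      · have h1' : W.analyticRank = 1 := by omega
        rw [h1']
        exact hLB1 W h1'
      · exact hLB2 W h2
    have h1 : (W.mordellWeilRank : ℕ∞) ≤ (padicLFunction f (unitRoot W p : ℚ_[p])).order :=
      hK W p (by omega) hO f hf
    have h2 : (padicLFunction f (unitRoot W p : ℚ_[p])).order ≤ (W.analyticRank : ℕ∞) := hub f hf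
    have h3 : (W.analyticRank : ℕ∞) ≤ (W.mordellWeilRank : ℕ∞) := by exact_mod_cast hLB
    exact ⟨p, hp, h5, hO, W.conductorNorm ℤ, hN, f, hf, le_antisymm h2 (h3.trans h1),
      le_antisymm (h2.trans h3) h1⟩

/-! ## Conversely: every stub from `X₅` (modulo Carayol) -/

/-- **`X₅ ⇒ stub_UB_pos` modulo Carayol.** Assume Carayol's theorem at every level
(`IsNewformOf.level_eq_conductorNorm`: a newform of `E` on `Γ₀(N)` has `N = N_E`; Carayol 1986,
Diamond–Shurman Thm 8.8.1) and `X₅`. Then the registered stub `stub_UB_pos` holds: at the prime `p ≥ 5`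
of `X₅` for `E` there is a newform `f₀` with `ord_{T=0} L_p(f₀, α_p, T) = r_an`; any newform `f` of `E`
on any `Γ₀(N)` has `N = N_E`, as does `f₀`, so `f = f₀` by the `q`-expansion principle
(`IsNewformOf.unique`) and `ord_{T=0} L_p(f, α_p, T) = r_an ≤ r_an`. [cite: Carayol1986] -/
theorem stub_UB_pos_of_level_eq_conductorNorm_of_thesisFiveLe
    (hlev : ∀ (N : ℕ) [NeZero N], IsNewformOf.level_eq_conductorNorm (N := N))
    (hX : ∀ (W : WeierstrassCurve ℚ) [W.IsElliptic] [W.IsGloballyMinimal],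
      ∃ (p : ℕ) (_ : Fact p.Prime), 5 ≤ p ∧ IsOrdinaryAt W p ∧
        ∃ (N : ℕ) (_ : NeZero N) (f : CuspForm (Gamma0 N) 2), IsNewformOf W f ∧
          (padicLFunction f (unitRoot W p : ℚ_[p])).order = W.analyticRank ∧
          (padicLFunction f (unitRoot W p : ℚ_[p])).order = W.mordellWeilRank) :
    ∀ (W : WeierstrassCurve ℚ) [W.IsElliptic] [W.IsGloballyMinimal], 0 < W.analyticRank →
      ∃ (p : ℕ) (_ : Fact p.Prime), 5 ≤ p ∧ IsOrdinaryAt W p ∧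
        ∀ {N : ℕ} [NeZero N] (f : CuspForm (Gamma0 N) 2), IsNewformOf W f →
          (padicLFunction f (unitRoot W p : ℚ_[p])).order ≤ (W.analyticRank : ℕ∞) := by
  intro W _ _ _
  obtain ⟨p, hp, h5, hord, N₀, hN₀, f₀, hf₀, han, -⟩ := hX W
  refine ⟨p, hp, h5, hord, fun {N} _ f hf ↦ ?_⟩
  have hN : N = W.conductorNorm ℤ := hlev N hf
  have hN' : N₀ = W.conductorNorm ℤ := hlev N₀ hf₀
  subst hN
  cases hN'
  rw [hf.unique hf₀, han]

/-- **`X₅ ⇒ stub_modularity` modulo Carayol.** Assume Carayol's theorem at every level and `X₅`. Then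
every elliptic `W/ℚ` has a newform of level `N_W`: pass to a global minimal model `C • W`
(`WeierstrassCurve.hasGlobalMinimalModel_rat_holds`, Silverman AEC VIII.8.3), take the newform `f` that
`X₅` provides there, of level `N = N_{C • W}` (Carayol) `= N_W` (`WeierstrassCurve.conductorNorm_smul`,
the conductor is an isomorphism invariant), and note `IsNewformOf (C • W) f ↔ IsNewformOf W f` because
the Dirichlet coefficients `aₙ` are isomorphism invariants (`WeierstrassCurve.LFunction_smul`).
[cite: Carayol1986] -/
theorem stub_modularity_of_level_eq_conductorNorm_of_thesisFiveLe
    (hlev : ∀ (N : ℕ) [NeZero N], IsNewformOf.level_eq_conductorNorm (N := N))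
    (hX : ∀ (W : WeierstrassCurve ℚ) [W.IsElliptic] [W.IsGloballyMinimal],
      ∃ (p : ℕ) (_ : Fact p.Prime), 5 ≤ p ∧ IsOrdinaryAt W p ∧
        ∃ (N : ℕ) (_ : NeZero N) (f : CuspForm (Gamma0 N) 2), IsNewformOf W f ∧
          (padicLFunction f (unitRoot W p : ℚ_[p])).order = W.analyticRank ∧
          (padicLFunction f (unitRoot W p : ℚ_[p])).order = W.mordellWeilRank) :
    ∀ (W : WeierstrassCurve ℚ) [W.IsElliptic] [NeZero (W.conductorNorm ℤ)],
      ∃ f : CuspForm (Gamma0 (W.conductorNorm ℤ)) 2, IsNewformOf W f := by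
  intro W _ _
  obtain ⟨C, hC⟩ := WeierstrassCurve.hasGlobalMinimalModel_rat_holds W
  haveI : (C • W).IsGloballyMinimal := hC
  obtain ⟨-, -, -, -, N, hN, f, hf, -, -⟩ := hX (C • W)
  have hlevN : N = (C • W).conductorNorm ℤ := hlev N hf
  rw [WeierstrassCurve.conductorNorm_smul ℤ W C] at hlevN
  subst hlevN
  refine ⟨f, hf.1, fun n ↦ ?_⟩
  rw [hf.2 n, WeierstrassCurve.LFunction_smul]

/-- `X₅ ⇒ stub_LB_rank1` (the two equalities of `X₅` give `r_an = r_MW`; `Nat.cast` injective). [folklore] -/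
theorem stub_LB_rank1_of_thesisFiveLe
    (hX : ∀ (W : WeierstrassCurve ℚ) [W.IsElliptic] [W.IsGloballyMinimal],
      ∃ (p : ℕ) (_ : Fact p.Prime), 5 ≤ p ∧ IsOrdinaryAt W p ∧
        ∃ (N : ℕ) (_ : NeZero N) (f : CuspForm (Gamma0 N) 2), IsNewformOf W f ∧
          (padicLFunction f (unitRoot W p : ℚ_[p])).order = W.analyticRank ∧
          (padicLFunction f (unitRoot W p : ℚ_[p])).order = W.mordellWeilRank) :
    ∀ (W : WeierstrassCurve ℚ) [W.IsElliptic] [W.IsGloballyMinimal],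
      W.analyticRank = 1 → 1 ≤ W.mordellWeilRank := by
  intro W _ _ h1
  obtain ⟨p, hp, -, -, N, hN, f, -, han, hmw⟩ := hX W
  have h : W.analyticRank = W.mordellWeilRank := by exact_mod_cast han.symm.trans hmw
  omega

/-- `X₅ ⇒ stub_LB_ge2` (same). [folklore] -/
theorem stub_LB_ge2_of_thesisFiveLe :
    (∀ (W : WeierstrassCurve ℚ) [W.IsElliptic] [W.IsGloballyMinimal],
      ∃ (p : ℕ) (_ : Fact p.Prime), 5 ≤ p ∧ IsOrdinaryAt W p ∧
        ∃ (N : ℕ) (_ : NeZero N) (f : CuspForm (Gamma0 N) 2), IsNewformOf W f ∧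
          (padicLFunction f (unitRoot W p : ℚ_[p])).order = W.analyticRank ∧
          (padicLFunction f (unitRoot W p : ℚ_[p])).order = W.mordellWeilRank) →
    ∀ (W : WeierstrassCurve ℚ) [W.IsElliptic] [W.IsGloballyMinimal],
      2 ≤ W.analyticRank → W.analyticRank ≤ W.mordellWeilRank := by
  intro hX W _ _ _
  obtain ⟨p, hp, -, -, N, hN, f, -, han, hmw⟩ := hX W
  have h : W.analyticRank = W.mordellWeilRank := by exact_mod_cast han.symm.trans hmw
  omega

/-! ## Tightness -/

/-- **The sandwich is tight.** Modulo the Kato side (`PAdicOrderKatoSideR2`, stmt-0491: Kato 2004,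
Thm 18.4, a theorem in print) and Carayol's theorem (`IsNewformOf.level_eq_conductorNorm` at every level,
in print), the strengthened thesis `X₅` (`X` with witness prime `≥ 5`) is EQUIVALENT to the conjunction
of the four open stubs of line `Sketch` — modularity at level `N_W`, the one-prime upper bound
`stub_UB_pos`, and the BSD lower bounds `stub_LB_rank1`, `stub_LB_ge2` — by `thesisFiveLe_of_sandwich`
and the three converses above. So the line's decomposition is lossless: no stub can be weakened and no
further input is hidden. [cite: Kato2004, Thm 18.4] -/
theorem sandwich_tight (hlev : ∀ (N : ℕ) [NeZero N], IsNewformOf.level_eq_conductorNorm (N := N))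
    (hK : PAdicOrderKatoSideR2) :
    (∀ (W : WeierstrassCurve ℚ) [W.IsElliptic] [W.IsGloballyMinimal],
      ∃ (p : ℕ) (_ : Fact p.Prime), 5 ≤ p ∧ IsOrdinaryAt W p ∧
        ∃ (N : ℕ) (_ : NeZero N) (f : CuspForm (Gamma0 N) 2), IsNewformOf W f ∧
          (padicLFunction f (unitRoot W p : ℚ_[p])).order = W.analyticRank ∧
          (padicLFunction f (unitRoot W p : ℚ_[p])).order = W.mordellWeilRank) ↔
    ((∀ (W : WeierstrassCurve ℚ) [W.IsElliptic] [NeZero (W.conductorNorm ℤ)],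
        ∃ f : CuspForm (Gamma0 (W.conductorNorm ℤ)) 2, IsNewformOf W f) ∧
      (∀ (W : WeierstrassCurve ℚ) [W.IsElliptic] [W.IsGloballyMinimal], 0 < W.analyticRank →
        ∃ (p : ℕ) (_ : Fact p.Prime), 5 ≤ p ∧ IsOrdinaryAt W p ∧
          ∀ {N : ℕ} [NeZero N] (f : CuspForm (Gamma0 N) 2), IsNewformOf W f →
            (padicLFunction f (unitRoot W p : ℚ_[p])).order ≤ (W.analyticRank : ℕ∞)) ∧
      (∀ (W : WeierstrassCurve ℚ) [W.IsElliptic] [W.IsGloballyMinimal],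
        W.analyticRank = 1 → 1 ≤ W.mordellWeilRank) ∧
      (∀ (W : WeierstrassCurve ℚ) [W.IsElliptic] [W.IsGloballyMinimal],
        2 ≤ W.analyticRank → W.analyticRank ≤ W.mordellWeilRank)) :=
  ⟨fun hX ↦ ⟨stub_modularity_of_level_eq_conductorNorm_of_thesisFiveLe hlev hX,
      stub_UB_pos_of_level_eq_conductorNorm_of_thesisFiveLe hlev hX,
      stub_LB_rank1_of_thesisFiveLe hX, stub_LB_ge2_of_thesisFiveLe hX⟩,
    fun ⟨hmod, hUB, hLB1, hLB2⟩ ↦ thesisFiveLe_of_sandwich hmod hK hUB hLB1 hLB2⟩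

end Summit.BirchSwinnertonDyer.BirchSwinnertonDyer.Cruxes.PAdicOrderThesisR2.KatoSandwich
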